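import Literature.IUT.HodgeTheaters.PMBaseBridgePropsProofs2

/-!
# Proofs over [IUTchI] Prop 6.6 (iii), (iv): isomorphisms of `𝒟-Θ^{±ell}`-Hodge theaters; gluing data

Mochizuki, *Inter-universal Teichmüller theory I*, §6, Proposition 6.6 (iii), (iv) pp. 165–166, kurims
manuscript (May 2020). PROOF-ONLY companion (theorems, no definitions) to abc-iut-L5-t4's
`PMBaseBridgeProps.lean`, by the L5 discharge seat abc-iut-L5-t13:

* **Prop 6.6 (iii), first clause**: isomorphisms between any two `𝒟-Θ^{±ell}`-Hodge theaters EXIST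
  (`DThetaPMEllHT.isoTorsor_nonempty`, the first conjunct of the named statement `DThetaPMEllHT.IsoTorsor`);
* **Prop 6.6 (iv), first and second clauses**: given a `𝒟-Θ^±`-bridge and a `𝒟-Θ^{ell}`-bridge, gluing
  data exist, and over EVERY isomorphism of `𝔽_l^±`-torsors `T ⥲ T'` between the index sets there is a
  gluing datum that glues (`GluingData.exists_glues`, `GluingData.exists_glues_of_compat` — the first two
  conjuncts of the named statement `GluingTorsor`; a negative relative sign is absorbed by reflecting the
  model coordinates of the `Θ^±`-side, whose model poly-morphisms `φ^{Θ±}_t` do not depend on `t`).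

The remaining clauses (bijectivity with the index-set isomorphisms; the `{±1}^𝕍`-torsor over a fixed
index bijection) need the rigidity of `±`-label classes under `labOfHom` and, for negative elements of
`𝔽_l^{⋊±}`, the `[−1]`-compatibility of `φ^{Θell}_{•,v}` (Example 6.3 (ii)); they are not asserted here.
Record only; [claim: Mochizuki2012, status: disputed]; nothing here takes a side on any disputed step.
-/

namespace Literature.IUT.HodgeTheaters

open CategoryTheory

universe u

/-! ### Index-set bookkeeping -/

namespace FlPMGroup

variable {l : ℕ} {T : Type*} (S : FlPMGroup l T)

/-- If `ι : 𝔽_l ⥲ T` is an isomorphism of `𝔽_l^±`-groups, tautological charts pull back along `ι⁻¹` to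
charts of `T`. [claim: Mochizuki2012, status: disputed] -/
theorem symm_trans_mem_of_compat {ι : ZMod l ≃ T}
    (hι : ∀ e ∈ S.charts, ι.trans e ∈ (FlPMGroup.tautological l).charts) {e₀ : ZMod l ≃ ZMod l}
    (he₀ : e₀ ∈ (FlPMGroup.tautological l).charts) : ι.symm.trans e₀ ∈ S.charts := by
  obtain ⟨e₁, he₁⟩ := S.nonempty
  obtain ⟨ε₁, hε₁⟩ := hι e₁ he₁
  obtain ⟨ε₀, rfl⟩ := he₀
  have h : ι.symm.trans (signPerm l ε₀) = e₁.trans (signPerm l (ε₀ * ε₁⁻¹)) := by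
    ext t
    have ht := congrArg (fun f : ZMod l ≃ ZMod l => f (ι.symm t)) hε₁
    simp only [Equiv.trans_apply, Equiv.apply_symm_apply, signPerm_apply] at ht
    simp only [Equiv.trans_apply, signPerm_apply, mul_smul, ← ht, inv_smul_smul]
  rw [h]
  exact S.trans_signPerm_mem he₁ _

/-- Reflecting an isomorphism of `𝔽_l^±`-groups `ι : 𝔽_l ⥲ T` (pre-composing with `z ↦ −z`) gives again an
isomorphism of `𝔽_l^±`-groups. [claim: Mochizuki2012, status: disputed] -/
theorem neg_trans_compat {ι : ZMod l ≃ T}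
    (hι : ∀ e ∈ S.charts, ι.trans e ∈ (FlPMGroup.tautological l).charts) :
    ∀ e ∈ S.charts, ((Equiv.neg (ZMod l)).trans ι).trans e ∈ (FlPMGroup.tautological l).charts := by
  intro e he
  obtain ⟨ε, hε⟩ := hι e he
  refine ⟨-ε, ?_⟩
  rw [Equiv.trans_assoc, ← hε]
  ext z
  simp [Units.smul_def]

end FlPMGroup

namespace FlPM

variable {l : ℕ}

/-- A translation acts on `𝔽_l` as `Equiv.addRight`. [claim: Mochizuki2012, status: disputed] -/
theorem toPerm_transl (c : ZMod l) : FlPM.toPerm l (transl c) = Equiv.addRight c := by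
  ext z
  simp

/-- A negative element `(c, −1)` acts on `𝔽_l` as `z ↦ −z + c`. [claim: Mochizuki2012, status: disputed] -/
theorem toPerm_of_isNegative {g : FlPM l} (hg : g.IsNegative) :
    FlPM.toPerm l g = (Equiv.neg (ZMod l)).trans (Equiv.addRight g.left.toAdd) := by
  ext z
  rw [IsNegative] at hg
  simp [FlPM.smul_def, hg, Units.smul_def]

end FlPM

namespace PMBaseKit

variable {l : ℕ} {K : PMBaseKit.{u} l}

/-- Translating the index of the model `Θ^{ell}`-poly-morphism inside a conjugate: `ellConj a γ (φ^{Θell}_{z+c})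
= ellConj a (b ∘ γ) (φ^{Θell}_z)` for a lift `b` of the translation `c` ([IUTchI] Ex 6.3 (i) p. 161).
[claim: Mochizuki2012, status: disputed] -/
theorem ellConj_poly_add {C : K.DStrip} {G : K.Glob} (a : (DStrip.model K).Iso C) (γ : K.gModel ≅ G)
    (z c : ZMod l) (v : K.V) {b : Aut K.gModel} (hb : b ∈ Ex63.lifts K (FlPM.transl c)) :
    K.ellConj a γ v (Ex63.poly K (z + c) v) = K.ellConj a (b ≪≫ γ) v (Ex63.poly K z v) := by
  rw [Ex63.poly_add z c v hb]
  ext h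
  constructor
  · rintro ⟨f, ⟨f₀, hf₀, rfl⟩, rfl⟩
    exact ⟨f₀, hf₀, by simp [← Functor.map_comp]⟩
  · rintro ⟨f₀, hf₀, rfl⟩
    exact ⟨f₀ ≫ (K.atV v).map b.hom, ⟨f₀, hf₀, rfl⟩, by simp [← Functor.map_comp]⟩

/-- The model poly-morphisms `φ^{Θ±}_t` of Example 6.2 (i) do not depend on the index `t`.
[claim: Mochizuki2012, status: disputed] -/
theorem Ex62.poly_neg (K : PMBaseKit.{u} l) (z : ZMod l) : Ex62.poly K (-z) = Ex62.poly K z := by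
  rw [Ex62.poly_eq, Ex62.poly_eq]

/-! ### Gluing data from coordinates ([IUTchI] Prop 6.6 (iv) p. 166) -/

/-- **Construction of gluing data.** Given model coordinates `(ι, α, β)` of a `𝒟-Θ^±`-bridge `B` and
`(ι', α', γ)` of a `𝒟-Θ^{ell}`-bridge `B'`, and `c ∈ 𝔽_l`, the capsule-`+`-full poly-isomorphism through
`α'_{z+c} ∘ α_z⁻¹` (index bijection `ι' ∘ (· + c) ∘ ι⁻¹`) GLUES `B` and `B'` to a `𝒟-Θ^{±ell}`-Hodge theater
([IUTchI] Prop 6.6 (iv) p. 166). [claim: Mochizuki2012, status: disputed] -/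
theorem GluingData.exists_of_coords (B : K.DThetaPMBridge) (B' : K.DThetaEllBridge)
    {ι : ZMod l ≃ B.T} (hι : ∀ e ∈ B.grpT.charts, ι.trans e ∈ (FlPMGroup.tautological l).charts)
    {α : ∀ z, (DStrip.model K).Iso (B.capsule (ι z))} {β : (DStrip.model K).Iso B.codomain}
    (hB : ∀ z, B.poly (ι z) = DStrip.polyConj (α z) β (Ex62.poly K z))
    {ι' : ZMod l ≃ B'.T} (hι' : ∀ e ∈ B'.torT.charts, ι'.trans e ∈ (FlPMTorsor.tautological l).charts)
    {α' : ∀ z, (DStrip.model K).Iso (B'.capsule (ι' z))} {γ : K.gModel ≅ B'.glob}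
    (hB' : ∀ z v, B'.poly (ι' z) v = K.ellConj (α' z) γ v (Ex63.poly K z v)) (c : ZMod l) :
    ∃ G : GluingData B B', G.Glues ∧ G.indexEquiv = ι.symm.trans ((Equiv.addRight c).trans ι') := by
  obtain ⟨b, hb⟩ := Ex63.lifts_nonempty (K := K) (FlPM.transl c)
  let αT : ∀ t : B.T, (DStrip.model K).Iso (B.capsule t) := fun t v =>
    α (ι.symm t) v ≪≫ eqToIso (congrArg (fun s => (B.capsule s).obj v) (ι.apply_symm_apply t))
  have hαT : ∀ z, αT (ι z) = α z := fun z =>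
    DStrip.isoCast_eq (fun s => B.capsule (ι s)) _ α (ι.symm_apply_apply z)
  refine ⟨{ indexEquiv := ι.symm.trans ((Equiv.addRight c).trans ι')
            poly := fun t => DStrip.plusFullPolyIso ((αT t).symm.trans (α' (ι.symm t + c)))
            poly_plusFull := fun t => ⟨_, rfl⟩ }, ⟨?_, ι, hι, α, β, b ≪≫ γ, hB, fun z v => ?_⟩, rfl⟩
  · -- the index bijection is an isomorphism of `𝔽_l^±`-torsors
    intro e he
    change ι.symm.trans (((Equiv.addRight c).trans ι').trans e) ∈ B.grpT.toTorsor.charts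
    rw [Equiv.trans_assoc]
    exact B.grpT.toTorsor.symm_trans_mem_of_compat (DThetaPMEllHT.indexEquiv_torsor_charts B.grpT ι hι)
      (FlPMTorsor.addRight_trans_mem_tautological c (hι' e he))
  · -- the transported `Θ^{ell}`-poly-morphisms are conjugates of the model ones
    change {h | ∃ p ∈ DStrip.plusFullPolyIso ((αT (ι z)).symm.trans (α' (ι.symm (ι z) + c))),
        ∃ g ∈ B'.poly (ι' (ι.symm (ι z) + c)) v, h = (p v).hom ≫ g} = _
    rw [hαT, hB', ellConj_capsule_side, Equiv.symm_apply_apply, ellConj_poly_add (α z) γ z c v hb]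

/-- **[IUTchI] Prop 6.6 (iv), second clause — DISCHARGED**: over every isomorphism of `𝔽_l^±`-torsors
`T ⥲ T'` between the index sets of a `𝒟-Θ^±`-bridge and a `𝒟-Θ^{ell}`-bridge there is a gluing datum that
glues them to a `𝒟-Θ^{±ell}`-Hodge theater (second conjunct of the named statement `GluingTorsor`; "the first
factor may be thought of as corresponding to the induced isomorphisms of `𝔽_l^±`-torsors between the index
sets", p. 166). [claim: Mochizuki2012, status: disputed] -/
theorem GluingData.exists_glues_of_compat (B : K.DThetaPMBridge) (B' : K.DThetaEllBridge)
    (κ : B.T ≃ B'.T) (hκ : B.grpT.toTorsor.Compat B'.torT κ) :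
    ∃ G : GluingData B B', G.Glues ∧ G.indexEquiv = κ := by
  obtain ⟨ι, hι, α, β, hB⟩ := B.exists_model
  obtain ⟨ι', hι', α', γ, hB'⟩ := B'.exists_model
  -- read `κ` in the model coordinates: an element `g₀` of `𝔽_l^{⋊±}`
  have hκ₀ : ι.trans (κ.trans ι'.symm) ∈ (FlPMTorsor.tautological l).charts := by
    have h := DThetaPMEllHT.indexEquiv_torsor_charts B.grpT ι hι _
      (hκ _ (B'.torT.symm_trans_mem_of_compat hι' (e₀ := Equiv.refl _) ⟨1, by
        show FlPM.toPerm l 1 = _; rw [map_one]; rfl⟩))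
    simpa only [Equiv.trans_refl] using h
  obtain ⟨g₀, hg₀⟩ := hκ₀
  have hκeq : κ = ι.symm.trans ((FlPM.toPerm l g₀).trans ι') := by
    ext t
    have ht := congrArg (fun f : ZMod l ≃ ZMod l => ι' (f (ι.symm t))) hg₀
    simpa using ht.symm
  rcases FlPM.isPositive_or_isNegative g₀ with hpos | hneg
  · obtain ⟨c, rfl⟩ := (FlPM.isPositive_iff_exists_transl g₀).mp hpos
    rw [FlPM.toPerm_transl] at hκeq
    subst hκeq
    exact GluingData.exists_of_coords B B' hι hB hι' hB' c
  · -- negative relative sign: reflect the coordinates of the `Θ^±`-side (`φ^{Θ±}_t` is index-free)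
    have hκeq' : κ = ((Equiv.neg (ZMod l)).trans ι).symm.trans
        ((Equiv.addRight g₀.left.toAdd).trans ι') := by
      rw [hκeq, FlPM.toPerm_of_isNegative hneg]
      ext t
      rfl
    clear hκeq
    subst hκeq'
    exact GluingData.exists_of_coords B B' (ι := (Equiv.neg (ZMod l)).trans ι) (B.grpT.neg_trans_compat hι)
      (α := fun z => α (-z)) (β := β) (fun z => by rw [← Ex62.poly_neg K z]; exact hB (-z)) hι' hB' _

/-- **[IUTchI] Prop 6.6 (iv), first clause — DISCHARGED**: given a `𝒟-Θ^±`-bridge and a `𝒟-Θ^{ell}`-bridge,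
gluing data that glue them to a `𝒟-Θ^{±ell}`-Hodge theater EXIST (first conjunct of the named statement
`GluingTorsor`). [claim: Mochizuki2012, status: disputed] -/
theorem GluingData.exists_glues (B : K.DThetaPMBridge) (B' : K.DThetaEllBridge) :
    ∃ G : GluingData B B', G.Glues := by
  obtain ⟨ι, hι, α, β, hB⟩ := B.exists_model
  obtain ⟨ι', hι', α', γ, hB'⟩ := B'.exists_model
  obtain ⟨G, hG, -⟩ := GluingData.exists_of_coords B B' hι hB hι' hB' 0
  exact ⟨G, hG⟩

/-! ### Proposition 6.6 (iii): isomorphisms of `𝒟-Θ^{±ell}`-Hodge theaters exist -/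

namespace DThetaPMEllHT

/-- **[IUTchI] Prop 6.6 (iii), first clause — DISCHARGED**: between any two `𝒟-Θ^{±ell}`-Hodge theaters
there is an isomorphism (first conjunct of the named statement `DThetaPMEllHT.IsoTorsor`): the pair of
bridge isomorphisms with common index bijection `ι₂ ∘ ι₁⁻¹` and common capsule-`+`-full poly-isomorphism
`α₂ ∘ α₁⁻¹ · Aut_+` ([IUTchI] Def 6.4 (iii) p. 163). [claim: Mochizuki2012, status: disputed] -/
theorem isoTorsor_nonempty (H₁ H₂ : K.DThetaPMEllHT) : Nonempty (Iso H₁ H₂) := by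
  obtain ⟨ι₁, hι₁, α₁, β₁, γ₁, hP₁, hE₁⟩ := H₁.exists_model
  obtain ⟨ι₂, hι₂, α₂, β₂, γ₂, hP₂, hE₂⟩ := H₂.exists_model
  obtain ⟨b, hb⟩ := Ex63.lifts_nonempty (K := K) (FlPM.transl 0)
  let αT : ∀ t : H₁.T, (DStrip.model K).Iso (H₁.capsule t) := fun t v =>
    α₁ (ι₁.symm t) v ≪≫ eqToIso (congrArg (fun s => (H₁.capsule s).obj v) (ι₁.apply_symm_apply t))
  have hαT : ∀ z, αT (ι₁ z) = α₁ z := fun z =>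
    DStrip.isoCast_eq (fun s => H₁.capsule (ι₁ s)) _ α₁ (ι₁.symm_apply_apply z)
  -- the common index bijection and capsule poly-isomorphism
  let κ : H₁.T ≃ H₂.T := ι₁.symm.trans ((Equiv.addRight 0).trans ι₂)
  let cp : ∀ t, Set ((H₁.capsule t).Iso (H₂.capsule (κ t))) := fun t =>
    DStrip.plusFullPolyIso ((αT t).symm.trans (α₂ (ι₁.symm t + 0)))
  have hκg : ∀ e ∈ H₂.grpT.charts, κ.trans e ∈ H₁.grpT.charts := by
    intro e he
    have h0 : κ = ι₁.symm.trans ι₂ := by ext t; simp [κ]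
    rw [h0, Equiv.trans_assoc]
    exact H₁.grpT.symm_trans_mem_of_compat hι₁ (hι₂ e he)
  refine ⟨{ pmIso :=
              { indexEquiv := κ
                indexEquiv_charts := hκg
                capsPoly := cp
                capsPoly_plusFull := fun t => ⟨_, rfl⟩
                codPoly := DStrip.plusFullPolyIso (β₁.symm.trans β₂)
                codPoly_plusFull := ⟨_, rfl⟩
                compat := fun t => ?_ }
            ellIso :=
              { indexEquiv := κ
                indexEquiv_charts := fun e he => ?_
                capsPoly := cp
                capsPoly_plusFull := fun t => ⟨_, rfl⟩
                globPoly := {ψ | ∃ c' ∈ K.autCsp H₂.glob, ψ = (γ₁.symm ≪≫ b ≪≫ γ₂) ≪≫ c'}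
                globPoly_orbit := ⟨_, rfl⟩
                compat := fun t v => ?_ }
            index_eq := fun t => rfl
            caps_eq := fun t p => ?_ }⟩
  · -- compatibility with `†φ^{Θ±}_±`, `‡φ^{Θ±}_±`
    obtain ⟨z, rfl⟩ := ι₁.surjective t
    change DStrip.polyComp (DStrip.plusFullPolyIso ((αT (ι₁ z)).symm.trans (α₂ (ι₁.symm (ι₁ z) + 0))))
        (H₂.polyPM (ι₂ (ι₁.symm (ι₁ z) + 0))) =
      DStrip.polyComp (H₁.polyPM (ι₁ z)) (DStrip.plusFullPolyIso (β₁.symm.trans β₂))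
    rw [hαT, hP₂, hP₁, Ex62.poly_eq, Ex62.poly_eq, DStrip.polyConj_plusFullPolyIso,
      DStrip.polyConj_plusFullPolyIso, DStrip.polyComp_plusFullPolyIso, DStrip.polyComp_plusFullPolyIso]
    congr 1
    funext v
    change ((α₁ z v).symm ≪≫ α₂ (ι₁.symm (ι₁ z) + 0) v) ≪≫
        (((α₂ (ι₁.symm (ι₁ z) + 0) v).symm ≪≫ CategoryTheory.Iso.refl _) ≪≫ β₂ v) =
      (((α₁ z v).symm ≪≫ CategoryTheory.Iso.refl _) ≪≫ β₁ v) ≪≫ ((β₁ v).symm ≪≫ β₂ v)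
    simp
  · -- the index bijection is an isomorphism of the induced `𝔽_l^±`-torsors
    change ι₁.symm.trans (((Equiv.addRight 0).trans ι₂).trans e) ∈ H₁.grpT.toTorsor.charts
    rw [Equiv.trans_assoc]
    exact H₁.grpT.toTorsor.symm_trans_mem_of_compat (indexEquiv_torsor_charts H₁.grpT ι₁ hι₁)
      (FlPMTorsor.addRight_trans_mem_tautological 0 (indexEquiv_torsor_charts H₂.grpT ι₂ hι₂ e he))
  · -- compatibility with `†φ^{Θell}_±`, `‡φ^{Θell}_±`
    obtain ⟨z, rfl⟩ := ι₁.surjective t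
    change {h | ∃ p ∈ DStrip.plusFullPolyIso ((αT (ι₁ z)).symm.trans (α₂ (ι₁.symm (ι₁ z) + 0))),
        ∃ g ∈ H₂.polyEll (ι₂ (ι₁.symm (ι₁ z) + 0)) v, h = (p v).hom ≫ g} =
      {h | ∃ f ∈ H₁.polyEll (ι₁ z) v,
        ∃ q ∈ {ψ : H₁.glob ≅ H₂.glob | ∃ c' ∈ K.autCsp H₂.glob, ψ = (γ₁.symm ≪≫ b ≪≫ γ₂) ≪≫ c'},
          h = f ≫ (K.atV v).map (q : H₁.glob ≅ H₂.glob).hom}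
    rw [hαT, hE₂, hE₁, ellConj_capsule_side, ellConj_global_side (α₁ z) γ₁ γ₂ z 0 v hb,
      Equiv.symm_apply_apply]
  · -- the two bridge isomorphisms induce the same capsule poly-isomorphism
    have hp : (fun v => p v ≪≫ eqToIso (rfl : (H₂.capsule (κ t)).obj v = (H₂.capsule (κ t)).obj v)) = p := by
      funext v
      simp
    exact Iff.of_eq (congrArg (· ∈ cp t) hp.symm)

end DThetaPMEllHT

end PMBaseKit

end Literature.IUT.HodgeTheaters
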